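import Literature.NumberTheory.Transcendental.OnePeriodsClosedPaths
import Literature.NumberTheory.Transcendental.CurvePeriodsProofs
import Mathlib.Analysis.Calculus.ContDiff.Deriv
import Mathlib.MeasureTheory.Integral.IntervalIntegral.FundThmCalculus
import Mathlib.Analysis.SpecialFunctions.Complex.Log
import Mathlib.Analysis.SpecialFunctions.ExpDeriv
import HarnessLib

/-!
# Complete periods of plane curves: the elementary half of Huber–Wüstholz, Cor. 13.13

Companion of `Literature/NumberTheory/Transcendental/OnePeriodsClosedPaths.lean`, which records
Huber–Wüstholz, *Transcendence and Linear Relations of 1-Periods* (Cambridge Tracts 227, 2022),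
**Corollary 13.13** (closed-path case, plane-curve form) as the named fact
`Literature.NumberTheory.Transcendental.completePlaneCurvePeriods_zero_or_transcendental`:
for `p, A, B ∈ ℚ[x, y]`, closed `C¹` loops `γᵢ` in the smooth locus of `p = 0` and `nᵢ ∈ ℤ`, the
complete period `S = Σᵢ nᵢ ∮_{γᵢ} (A dx + B dy)` is `0` as soon as it is algebraic.

The printed proof of Cor. 13.13 (p. 126 of the held text) has two ingredients:

1. **Theorem 13.9** (p. 125): if `α = ∫_σ ω` is algebraic then `ω = df + φ` with `∫_σ φ = 0` —
   this is Thm. 9.11 for the 1-motive `[ℤ[D]⁰ → J(C°)]`, i.e. the Subgroup Theorem for 1-motives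
   (Thm. 9.7) and ultimately Wüstholz's Analytic Subgroup Theorem (Thm. 6.2), together with
   generalised Jacobians and the de Rham/singular realisations of 1-motives (Lemma 12.9). None of
   this machinery exists in Mathlib; it is NOT reproduced here and the named fact stays a fact.
2. the elementary step **"if the boundary divisor vanishes, then `∫_σ df = ∫_{∂σ} f = 0` for all
   `f`"** — the fundamental theorem of calculus along each closed loop.

This file proves ingredient 2 in the exact data format of the named fact, and its immediate
consequences:

* `ClosedPathPeriods.hasDerivAt_aeval_comp` — chain rule for `t ↦ P(γ(t))`, `P ∈ ℚ[x₁,…,xₙ]`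
  (from `CurvePeriods.hasDerivAt_eval_comp`);
* `ClosedPathPeriods.integral_formD_eq_zero` — `∮_γ dP = ∫₀¹ (Pₓ(γ)γ₀′ + P_y(γ)γ₁′) dt = 0` for a
  `C¹` loop `γ : ℝ → ℂ²` of period `1` (no curve and no algebraicity needed);
* `completePlaneCurvePeriods_formD_eq_zero` — the conclusion of the named fact holds outright for
  EXACT forms `(A, B) = (∂P/∂x, ∂P/∂y)`: `Σᵢ nᵢ ∮_{γᵢ} dP = 0`;
* `ClosedPathPeriods.integral_add_formD` — the complete period of `A dx + B dy` along a closed loop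
  is unchanged under `(A, B) ↦ (A + ∂P/∂x, B + ∂P/∂y)`, i.e. it only depends on the class of the
  form modulo exact forms (the reduction to `H¹_dR = Ω¹/d𝒪` used in the translation of Cor. 13.13
  to plane curves, module docstring of `OnePeriodsClosedPaths.lean`).
* `ClosedPathPeriods.exists_completePeriod_eq_two_pi_I` — NON-VACUITY / calibration: the
  hyperbola `xy = 1`, the form `y dx` and the loop `(e^{2πit}, e^{−2πit})` satisfy every hypothesis
  of the named fact and have complete period `2πi ≠ 0`;
* `completePlaneCurvePeriods_zero_or_transcendental.transcendental_two_pi_I` — hence the named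
  fact contains the transcendence of `2πi` (book, Remark 13.10); unconditionally this instance is
  `transcendental_pi_holds` (Lindemann–Weierstrass, `LindemannWeierstrassProofs.lean`), which is
  deliberately not imported here.

## References

* A. Huber, G. Wüstholz, *Transcendence and Linear Relations of 1-Periods*, Cambridge Tracts in
  Mathematics 227, CUP 2022, doi:10.1017/9781009019729 [HuberWustholz2022]: Cor. 13.13 and its
  proof (p. 126), Thm. 13.9 (p. 125), Thm. 9.11 (pp. 92–93), Thm. 9.7 (p. 90).
-/

noncomputable section

open MvPolynomial

namespace Literature.NumberTheory.Transcendental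

namespace ClosedPathPeriods

/-- **Chain rule** for a polynomial with rational coefficients along a path in `ℂⁿ`: if every
coordinate `γᵢ` has derivative `γ′ᵢ` at `t`, then `u ↦ P(γ(u))` has derivative
`Σᵢ (∂P/∂xᵢ)(γ(t)) · γ′ᵢ` at `t` (base change of `CurvePeriods.hasDerivAt_eval_comp` along
`ℚ → ℂ`). [folklore] -/
theorem hasDerivAt_aeval_comp {n : ℕ} {γ : ℝ → (Fin n → ℂ)} {γ' : Fin n → ℂ} {t : ℝ}
    (hγ : ∀ i, HasDerivAt (fun u => γ u i) (γ' i) t) (P : MvPolynomial (Fin n) ℚ) :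
    HasDerivAt (fun u => aeval (γ u) P) (∑ i, aeval (γ t) (pderiv i P) * γ' i) t := by
  have e : ∀ (Q : MvPolynomial (Fin n) ℚ) (x : Fin n → ℂ),
      eval x (map (algebraMap ℚ ℂ) Q) = aeval x Q := fun Q x => by
    rw [eval_map, aeval_def]
  have h := CurvePeriods.hasDerivAt_eval_comp hγ (map (algebraMap ℚ ℂ) P)
  simp only [pderiv_map, e] at h
  exact h

/-- Each coordinate of a `C¹` map `γ : ℝ → ℂⁿ` has a derivative everywhere. [folklore] -/
theorem hasDerivAt_apply_of_contDiff {n : ℕ} {γ : ℝ → (Fin n → ℂ)} (hγ : ContDiff ℝ 1 γ)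
    (i : Fin n) (t : ℝ) :
    HasDerivAt (fun u => γ u i) (deriv (fun u => γ u i) t) t :=
  (((contDiff_pi.1 hγ i).differentiable one_ne_zero) t).hasDerivAt

/-- The derivative of each coordinate of a `C¹` map `γ : ℝ → ℂⁿ` is continuous. [folklore] -/
theorem continuous_deriv_apply_of_contDiff {n : ℕ} {γ : ℝ → (Fin n → ℂ)} (hγ : ContDiff ℝ 1 γ)
    (i : Fin n) : Continuous (deriv fun u => γ u i) :=
  (contDiff_pi.1 hγ i).continuous_deriv le_rfl

/-- `t ↦ Q(γ(t))` is continuous for a `C¹` map `γ : ℝ → ℂⁿ` and `Q ∈ ℚ[x₁, …, xₙ]`. [folklore] -/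
theorem continuous_aeval_comp_of_contDiff {n : ℕ} {γ : ℝ → (Fin n → ℂ)} (hγ : ContDiff ℝ 1 γ)
    (Q : MvPolynomial (Fin n) ℚ) : Continuous fun u => aeval (γ u) Q :=
  continuous_iff_continuousAt.2 fun t =>
    (hasDerivAt_aeval_comp (fun i => hasDerivAt_apply_of_contDiff hγ i t) Q).continuousAt

/-- The integrand `Pₓ(γ(t)) γ₀′(t) + P_y(γ(t)) γ₁′(t)` of `∮_γ dP` is the derivative of
`t ↦ P(γ(t))`, for a `C¹` map `γ : ℝ → ℂ²`. [folklore] -/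
theorem hasDerivAt_aeval_comp_two {γ : ℝ → (Fin 2 → ℂ)} (hγ : ContDiff ℝ 1 γ)
    (P : MvPolynomial (Fin 2) ℚ) (t : ℝ) :
    HasDerivAt (fun u => aeval (γ u) P)
      (aeval (γ t) (pderiv 0 P) * deriv (fun s => γ s 0) t +
        aeval (γ t) (pderiv 1 P) * deriv (fun s => γ s 1) t) t := by
  have h := hasDerivAt_aeval_comp (fun i => hasDerivAt_apply_of_contDiff hγ i t) P
  rwa [Fin.sum_univ_two] at h

/-- The integrand of `∮_γ dP` is continuous for a `C¹` map `γ : ℝ → ℂ²`. [folklore] -/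
theorem continuous_formD_integrand {γ : ℝ → (Fin 2 → ℂ)} (hγ : ContDiff ℝ 1 γ)
    (P : MvPolynomial (Fin 2) ℚ) :
    Continuous fun t => aeval (γ t) (pderiv 0 P) * deriv (fun s => γ s 0) t +
        aeval (γ t) (pderiv 1 P) * deriv (fun s => γ s 1) t :=
  ((continuous_aeval_comp_of_contDiff hγ _).mul (continuous_deriv_apply_of_contDiff hγ 0)).add
    ((continuous_aeval_comp_of_contDiff hγ _).mul (continuous_deriv_apply_of_contDiff hγ 1))

/-- The integrand of `∮_γ (A dx + B dy)` is continuous for a `C¹` map `γ : ℝ → ℂ²`. [folklore] -/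
theorem continuous_form_integrand {γ : ℝ → (Fin 2 → ℂ)} (hγ : ContDiff ℝ 1 γ)
    (A B : MvPolynomial (Fin 2) ℚ) :
    Continuous fun t => aeval (γ t) A * deriv (fun s => γ s 0) t +
        aeval (γ t) B * deriv (fun s => γ s 1) t :=
  ((continuous_aeval_comp_of_contDiff hγ A).mul (continuous_deriv_apply_of_contDiff hγ 0)).add
    ((continuous_aeval_comp_of_contDiff hγ B).mul (continuous_deriv_apply_of_contDiff hγ 1))

/-- **`∫_γ dP = P(γ(b)) − P(γ(a))`** for a `C¹` map `γ : ℝ → ℂ²` and `P ∈ ℚ[x, y]` (fundamental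
theorem of calculus; Huber–Wüstholz, p. 124: "`∫_γ ω = f(γ(1)) − f(γ(0))`" for `ω = df`).
[cite: HuberWustholz2022, §13.2.2 (p. 124)] -/
theorem integral_formD_eq_sub {γ : ℝ → (Fin 2 → ℂ)} (hγ : ContDiff ℝ 1 γ)
    (P : MvPolynomial (Fin 2) ℚ) (a b : ℝ) :
    (∫ t in a..b, (aeval (γ t) (pderiv 0 P) * deriv (fun s => γ s 0) t +
        aeval (γ t) (pderiv 1 P) * deriv (fun s => γ s 1) t)) =
      aeval (γ b) P - aeval (γ a) P :=
  intervalIntegral.integral_eq_sub_of_hasDerivAt (fun t _ => hasDerivAt_aeval_comp_two hγ P t)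
    ((continuous_formD_integrand hγ P).intervalIntegrable a b)

/-- **Closed loops kill exact forms**: `∮_γ dP = 0` for a `C¹` loop `γ : ℝ → ℂ²` of period `1` and
`P ∈ ℚ[x, y]` — the step "if the boundary divisor vanishes then `∫_σ df = ∫_{∂σ} f = 0`" of the
printed proof of Huber–Wüstholz, Cor. 13.13. [cite: HuberWustholz2022, proof of Cor. 13.13 (p. 126)] -/
theorem integral_formD_eq_zero {γ : ℝ → (Fin 2 → ℂ)} (hγ : ContDiff ℝ 1 γ)
    (hper : Function.Periodic γ 1) (P : MvPolynomial (Fin 2) ℚ) :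
    (∫ t in (0:ℝ)..1, (aeval (γ t) (pderiv 0 P) * deriv (fun s => γ s 0) t +
        aeval (γ t) (pderiv 1 P) * deriv (fun s => γ s 1) t)) = 0 := by
  rw [integral_formD_eq_sub hγ P 0 1]
  have h1 : γ 1 = γ 0 := by simpa using hper 0
  rw [h1, sub_self]

/-- **Complete periods along closed loops only depend on the form modulo exact forms**:
`∮_γ ((A + Pₓ) dx + (B + P_y) dy) = ∮_γ (A dx + B dy)` for a `C¹` loop `γ` of period `1`
(so the complete period is a pairing with the class of `A dx + B dy` in `Ω¹/d𝒪`). [folklore] -/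
theorem integral_add_formD {γ : ℝ → (Fin 2 → ℂ)} (hγ : ContDiff ℝ 1 γ)
    (hper : Function.Periodic γ 1) (A B P : MvPolynomial (Fin 2) ℚ) :
    (∫ t in (0:ℝ)..1, (aeval (γ t) (A + pderiv 0 P) * deriv (fun s => γ s 0) t +
        aeval (γ t) (B + pderiv 1 P) * deriv (fun s => γ s 1) t)) =
      ∫ t in (0:ℝ)..1, (aeval (γ t) A * deriv (fun s => γ s 0) t +
        aeval (γ t) B * deriv (fun s => γ s 1) t) := by
  have hsplit : (fun t => aeval (γ t) (A + pderiv 0 P) * deriv (fun s => γ s 0) t +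
        aeval (γ t) (B + pderiv 1 P) * deriv (fun s => γ s 1) t) =
      fun t => (aeval (γ t) A * deriv (fun s => γ s 0) t +
          aeval (γ t) B * deriv (fun s => γ s 1) t) +
        (aeval (γ t) (pderiv 0 P) * deriv (fun s => γ s 0) t +
          aeval (γ t) (pderiv 1 P) * deriv (fun s => γ s 1) t) := by
    funext t
    simp only [map_add]
    ring
  rw [hsplit, intervalIntegral.integral_add ((continuous_form_integrand hγ A B).intervalIntegrable 0 1)
    ((continuous_formD_integrand hγ P).intervalIntegrable 0 1), integral_formD_eq_zero hγ hper P,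
    add_zero]

end ClosedPathPeriods

/-- **The exact-form case of `completePlaneCurvePeriods_zero_or_transcendental` holds outright**:
for `P ∈ ℚ[x, y]`, closed `C¹` loops `γᵢ : ℝ → ℂ²` of period `1` and `nᵢ ∈ ℤ`, the complete period
`Σᵢ nᵢ ∮_{γᵢ} dP = Σᵢ nᵢ ∫₀¹ (Pₓ(γᵢ) (γᵢ)₀′ + P_y(γᵢ) (γᵢ)₁′) dt` vanishes (whether or not the
loops lie on a curve). This is the conclusion of the named fact for `(A, B) = (∂P/∂x, ∂P/∂y)` and
the elementary half of the printed proof of Huber–Wüstholz, Cor. 13.13 ("`∫_σ df = ∫_{∂σ} f = 0`");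
the other half, Thm. 13.9, rests on the Analytic Subgroup Theorem and is not formalised.
[cite: HuberWustholz2022, proof of Cor. 13.13 (p. 126)] -/
theorem completePlaneCurvePeriods_formD_eq_zero (P : MvPolynomial (Fin 2) ℚ) (k : ℕ)
    (n : Fin k → ℤ) (γ : Fin k → ℝ → (Fin 2 → ℂ))
    (hγ : ∀ i, ContDiff ℝ 1 (γ i) ∧ Function.Periodic (γ i) 1) :
    (∑ i, (n i : ℂ) * ∫ t in (0:ℝ)..1,
      (aeval (γ i t) (pderiv 0 P) * deriv (fun s => γ i s 0) t +
        aeval (γ i t) (pderiv 1 P) * deriv (fun s => γ i s 1) t)) = 0 :=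
  Finset.sum_eq_zero fun i _ => by
    rw [ClosedPathPeriods.integral_formD_eq_zero (hγ i).1 (hγ i).2 P, mul_zero]

/-! ### Non-vacuity: the hyperbola loop has complete period `2πi` -/

section Calibration

open Complex
open scoped Real

namespace ClosedPathPeriods

/-- The exponential loop `t ↦ e^{c t}` (`c ∈ ℂ`) as a map `ℝ → ℂ` has derivative `c e^{c t}`. [folklore] -/
theorem hasDerivAt_exp_const_mul_ofReal (c : ℂ) (t : ℝ) :
    HasDerivAt (fun s : ℝ => exp (c * s)) (c * exp (c * t)) t := by
  have h1 : HasDerivAt (fun z : ℂ => c * z) c (t : ℂ) := by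
    simpa using (hasDerivAt_id (t : ℂ)).const_mul c
  have h2 : HasDerivAt (fun z : ℂ => exp (c * z)) (exp (c * t) * c) (t : ℂ) :=
    (Complex.hasDerivAt_exp (c * t)).comp (t : ℂ) h1
  rw [mul_comm]
  exact h2.comp_ofReal

/-- `t ↦ e^{c t}` is smooth as a map `ℝ → ℂ`. [folklore] -/
theorem contDiff_exp_const_mul_ofReal (c : ℂ) {m : WithTop ℕ∞} :
    ContDiff ℝ m (fun s : ℝ => exp (c * s)) :=
  Complex.contDiff_exp.comp (contDiff_const.mul Complex.ofRealCLM.contDiff)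

/-- **Non-vacuity / calibration of the named fact.** The hyperbola `xy = 1` (smooth locus = the
whole curve, `∂(xy − 1)/∂x = y ≠ 0` on it), the polynomial form `y dx` (`= dx/x` on the curve) and
the closed loop `γ(t) = (e^{2πit}, e^{−2πit})` satisfy all hypotheses of
`completePlaneCurvePeriods_zero_or_transcendental`, and the complete period is
`∮_γ y dx = ∫₀¹ e^{−2πit} · 2πi e^{2πit} dt = 2πi ≠ 0`. So the hypotheses of the fact do not force
the period to vanish, and the fact contains the transcendence of `2πi` (Lindemann) as its simplest
instance (Huber–Wüstholz, Remark 13.10: "The theorem includes famous cases like the transcendence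
of π"). [cite: HuberWustholz2022, Remark 13.10 (p. 125)] -/
theorem exists_completePeriod_eq_two_pi_I :
    ∃ γ : ℝ → (Fin 2 → ℂ), ContDiff ℝ 1 γ ∧ Function.Periodic γ 1 ∧
      (∀ t, aeval (γ t) (X 0 * X 1 - 1 : MvPolynomial (Fin 2) ℚ) = 0 ∧
        ∃ j, aeval (γ t) (pderiv j (X 0 * X 1 - 1 : MvPolynomial (Fin 2) ℚ)) ≠ 0) ∧
      (∫ t in (0:ℝ)..1, (aeval (γ t) (X 1 : MvPolynomial (Fin 2) ℚ) * deriv (fun s => γ s 0) t +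
        aeval (γ t) (0 : MvPolynomial (Fin 2) ℚ) * deriv (fun s => γ s 1) t)) = 2 * π * I := by
  -- the loop, coordinatewise: `γ t i = exp (c i * t)` with `c = (2πi, −2πi)`
  set c : Fin 2 → ℂ := ![2 * π * I, -(2 * π * I)] with hc
  have hc0 : c 0 = 2 * π * I := rfl
  have hc1 : c 1 = -(2 * π * I) := rfl
  have hexpc : ∀ i, exp (c i) = 1 := by
    intro i
    fin_cases i
    · exact Complex.exp_two_pi_mul_I
    · show exp (-(2 * π * I)) = 1
      rw [Complex.exp_neg, Complex.exp_two_pi_mul_I, inv_one]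
  refine ⟨fun t i => exp (c i * t), ?_, ?_, ?_, ?_⟩
  · exact contDiff_pi.2 fun i => contDiff_exp_const_mul_ofReal (c i)
  · intro t
    funext i
    show exp (c i * ((t + 1 : ℝ) : ℂ)) = exp (c i * (t : ℂ))
    rw [Complex.ofReal_add, Complex.ofReal_one, mul_add, mul_one, Complex.exp_add, hexpc i, mul_one]
  · intro t
    have hprod : exp (c 0 * (t : ℂ)) * exp (c 1 * (t : ℂ)) = 1 := by
      rw [← Complex.exp_add, hc0, hc1, neg_mul, add_neg_cancel, Complex.exp_zero]
    refine ⟨?_, 0, ?_⟩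
    · simp only [map_sub, map_mul, aeval_X, map_one]
      rw [hprod, sub_self]
    · have hpd : pderiv 0 (X 0 * X 1 - 1 : MvPolynomial (Fin 2) ℚ) = X 1 := by
        rw [map_sub, pderiv_one, sub_zero, pderiv_mul, pderiv_X_self,
          pderiv_X_of_ne (i := 0) (j := 1) (by decide), mul_zero, add_zero, one_mul]
      rw [hpd, aeval_X]
      exact Complex.exp_ne_zero _
  · have hderiv0 : ∀ t : ℝ, deriv (fun s : ℝ => exp (c 0 * s)) t = c 0 * exp (c 0 * t) :=
      fun t => (hasDerivAt_exp_const_mul_ofReal (c 0) t).deriv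
    have hint : ∀ t : ℝ, (aeval (fun i => exp (c i * t)) (X 1 : MvPolynomial (Fin 2) ℚ) *
        deriv (fun s : ℝ => exp (c 0 * s)) t +
        aeval (fun i => exp (c i * t)) (0 : MvPolynomial (Fin 2) ℚ) *
        deriv (fun s : ℝ => exp (c 1 * s)) t) = 2 * π * I := by
      intro t
      rw [aeval_X, map_zero, zero_mul, add_zero, hderiv0 t, hc0, hc1]
      have hprod : exp (-(2 * π * I) * (t : ℂ)) * exp (2 * π * I * (t : ℂ)) = 1 := by
        rw [← Complex.exp_add, neg_mul, neg_add_cancel, Complex.exp_zero]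
      calc exp (-(2 * π * I) * (t : ℂ)) * (2 * π * I * exp (2 * π * I * (t : ℂ)))
          = 2 * π * I * (exp (-(2 * π * I) * (t : ℂ)) * exp (2 * π * I * (t : ℂ))) := by ring
        _ = 2 * π * I := by rw [hprod, mul_one]
    show (∫ t in (0:ℝ)..1, (aeval (fun i => exp (c i * t)) (X 1 : MvPolynomial (Fin 2) ℚ) *
        deriv (fun s : ℝ => exp (c 0 * s)) t +
        aeval (fun i => exp (c i * t)) (0 : MvPolynomial (Fin 2) ℚ) *
        deriv (fun s : ℝ => exp (c 1 * s)) t)) = 2 * π * I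
    simp_rw [hint]
    rw [intervalIntegral.integral_const, sub_zero, one_smul]

end ClosedPathPeriods

/-- **The named fact contains the transcendence of `2πi`.** Applied to the hyperbola datum of
`ClosedPathPeriods.exists_completePeriod_eq_two_pi_I` (one loop, `n₁ = 1`, complete period
`2πi ≠ 0`), `completePlaneCurvePeriods_zero_or_transcendental` yields that `2πi` is transcendental
— Huber–Wüstholz, Remark 13.10 ("The theorem includes famous cases like the transcendence of
π"); in the tree this instance is known unconditionally (`transcendental_pi_holds`,
Lindemann–Weierstrass). [cite: HuberWustholz2022, Remark 13.10 (p. 125) and Cor. 13.13 (p. 126)] -/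
theorem completePlaneCurvePeriods_zero_or_transcendental.transcendental_two_pi_I
    (h : completePlaneCurvePeriods_zero_or_transcendental) :
    Transcendental ℚ (2 * π * I : ℂ) := by
  obtain ⟨γ, hγ, hper, hon, hS⟩ := ClosedPathPeriods.exists_completePeriod_eq_two_pi_I
  intro halg
  have h1 := h (X 0 * X 1 - 1) (X 1) 0 1 (fun _ => 1) (fun _ => γ) (fun _ => ⟨hγ, hper, hon⟩)
  simp only [Fin.sum_univ_one, Int.cast_one, one_mul] at h1
  have h2 : (2 * π * I : ℂ) = 0 := by rw [← hS]; exact h1 (by rw [hS]; exact halg)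
  have h3 : (2 * π * I : ℂ) ≠ 0 := by
    simp [Real.pi_ne_zero, Complex.I_ne_zero]
  exact h3 h2

end Calibration

end Literature.NumberTheory.Transcendental

end
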